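import Literature.Computability.AlgebraicComplexity.RankMethodBarriers
import Mathlib.RingTheory.MvPolynomial.Homogeneous
import HarnessLib

/-!
# Barrier catalogue `ValiantsHypothesis`: barriers for LIFTING rank lower bounds
(Garg–Makam–Oliveira–Wigderson 2019) — even optimal tensor-rank lower bounds for `k`-tensors
cannot certify rank above `k^d · n^{⌊(k-1)d/k⌋}` for `d`-tensors

D-0021 barrier entry for the summit `ValiantsHypothesis` (`VP_ℂ ≠ VNP_ℂ`), companion of
`Literature.Barriers.ValiantsHypothesis.RankMethods` (EGOW 2018: MATRIX-rank methods, `k = 2`).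
Technique class: *generalised rank methods* (lifting / escalation) — sub-additive measures
`μ_φ(v) = trk(φ(v))` obtained from a linear map `φ` into `k`-tensors (`T_k`-rank methods,
Def. 1.12), i.e. deriving tensor-rank (or Waring-rank) lower bounds in degree `d` from
tensor-rank lower bounds in degree `k < d`, however these are obtained ("even such (possibly
hard to prove) lower bounds", §1). The barrier: the potency of every such method is within the
constant `k^d` of the trivial regrouping of factors, "Indeed, as with matrix-rank methods, even
optimal lower bounds on the rank of degree `k` tensors (polynomials) cannot yield any nontrivial
lower bounds for any `d > k` for any fixed `d`, (up to constant factors)" (§1).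

**The printed results** (arXiv:1904.04299 = FOCS 2019, checked with `lit read`; "Throughout
this paper, our ground field (denoted `𝔽`) will be an algebraically closed field of
characteristic zero", §1).

* Def. 1.1 (`S`-rank `rk_S(v)`), Def. 1.2 (tensor rank `trk` on `Ten(n,d) = (𝔽^n)^{⊗d}`, simples
  `v₁ ⊗ ⋯ ⊗ v_d`), Def. 1.4 (Waring rank, simples `ℓ^d`, `ℓ ∈ P(n,1)`), Def. 1.6 (sub-additive
  measure, `rk_S(v) ≥ μ(v)/μ(S)`), Def. 1.7 (potency `Pot(μ) = μ(V)/μ(S)`), Def. 1.8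
  (matrix-rank method), Thm. 1.10–1.11 ([EGOW18], tree: `CplxAlg.EGOW2018_thm11/thm12`).
* Def. 1.12: "A linear map `φ : V → Ten(m,k)` is called a `T_k`-rank method. ... `μ_φ(v) =
  trk(φ(v))` ... `Pot(φ) = μ_φ(V)/μ_φ(S)`." Example 1.13: the trivial `T_k`-method (regrouping
  `d = rk` factors into `k` groups) has potency `Ω(n^{r(k-1)})`, `n^{r(k-1)} = n^{⌊(k-1)d/k⌋}`.
* Thm. 1.14: "Suppose that the ground field is algebraically closed and characteristic zero. For
  any `T_k`-rank method `φ : Ten(n,d) → Ten(m,k)`, its potency `Pot(φ) ≤ A_{d,k} · n^{⌊(k-1)d/k⌋}`,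
  where `A_{d,k} = k^d`." "The theorem holds for all values of `k, d, n, m`!" (standing range
  `d > k ≥ 2`, §1.4). Rem. 1.15: for `Ten(n,4)` "even if one had access to an oracle for tensor
  rank of 3-tensors, one could still not prove super-quadratic lower bounds".
* Thm. 1.16: the same for `T_k`-rank methods `φ : P(n,d) → Ten(m,k)` on forms, potency
  `≤ B_{d,k} · n^{⌊(k-1)d/k⌋}` "for some constant `B_{d,k}` depending only on `d` and `k`".
  Def. 1.17 / Thms. 1.18–1.19: `W_k`-rank methods (Waring rank of `φ(v) ∈ P(m,k)`), constants
  `C_{d,k} = 2^{k-1} k^d` and `2^{k-1} B_{d,k}`. §1.6: border rank, cactus rank,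
  set-multihomogeneous rank versions (§§7–8). Thm. 1.21 / Cor. 1.23: the numeric-to-symbolic
  transfer (if `trk(L(β)) ≤ a` for all evaluations of a polynomial map `L : 𝔽^n → Ten(m,k)` then
  `L(z + c)` has a symbolic power-series decomposition with `a` terms).
* §1 (the route this bears on): "optimal lower bounds on `k`-tensors (for `k` superconstant and
  `≤ log(n)/log(log(n))` where `n` is the local dimension) can be lifted to lower bounds on some
  stronger arithmetic models; Raz [Raz-elusive] shows how they can imply super-polynomial formula
  lower bounds! We find that better understanding and reconciling these results is needed."
  "while the barriers of [EGOW18] are valid in fields of arbitrary characteristic, our more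
  general results in this paper only hold for characteristic zero."

**Rendering.** Tensors, rank-one tensors and tensor rank are the tree's
`(Fin d → Fin n) → F`, `CplxAlg.rankOneTensor`, `CplxAlg.tensorRankD` (`RankMethodBarriers.lean`);
a `T_k`-rank method on `Ten(n,d)` is a linear map into `(Fin k → Fin m) → F`; on forms, a linear
map on `MvPolynomial (Fin n) F` evaluated on homogeneous polynomials of degree `d` (any linear
map on `P(n,d)` extends), simples `ℓ^d` with `ℓ` a LINEAR form (`CplxAlg.linearForm`, Def. 1.4).
"Potency `≤ C`" is rendered multiplicatively, as in the tree's EGOW facts: for every bound `r` on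
the measure of the simples, the measure of every element is `≤ C · r`. The technique class
`TkRankMethodProves` is "a `T_k`-rank method certifies `trk(T) > B`" (`B · r < trk(φ T)` while all
simples have measure `≤ r`), exactly parallel to `TensorRankMethodProves` of the companion file.

**What this file does.** Named facts `GMOW2019_thm114` (explicit constant `k^d`, stated for
`k ≥ 2`) and `GMOW2019_thm116` (existential constant); the barrier fact `RankLifting` is their
conjunction; PROVED no-go consequences `RankLifting.not_tkRankMethodProves` (no `T_k`-method
certifies tensor rank above `k^d · n^{⌊(k-1)d/k⌋}`), its `Ten(n,4)`/`k = 3` instance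
(`81 n²`, Rem. 1.15), and the form version with the existential constant; the NARROWED catalogue entry
`RankLiftingNarrow` (barrier audit 2026-08-16: certificate form, corrected technique class, evasions —
PT-rank escalation, nonlinear Kronecker-power flattenings, super-constant `k`, characteristic `p`)
with `RankLifting.certifies_lt`, `RankLifting.waring_certifies_lt`,
`RankLiftingNarrow.four_three_cube`, `.tensorPower_gap`, `.pow_le_ceiling_double`.

## References

* [GargMakamOliveiraWigderson2019] A. Garg, V. Makam, R. Oliveira, A. Wigderson, *More barriers
  for rank methods, via a "numeric to symbolic" transfer*, FOCS 2019 (arXiv:1904.04299), §1,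
  Defs. 1.1–1.8, 1.12, 1.17, Ex. 1.13, Thms. 1.10–1.11, 1.14, 1.16, 1.18–1.19, 1.21, Rem. 1.15,
  Cor. 1.23, §1.6.
* [EfremenkoGargOliveiraWigderson2018] (tree key) Thm. 1.1–1.2.
* [Raz2013] (tree key) §1.4 — the tensor-rank route to formula lower bounds.
* [EfremenkoGargOliveiraWigderson2018] §6 (open problem 1: non-linear maps); [RossmanZhu2025]
  B. Rossman, D. Zhu, *Multi-quadratic sum-of-squares lower bounds imply VNC¹ ≠ VNP*, ITCS 2026
  (arXiv:2512.01227), Thms. 1.2, 1.5, Cor. 1.6, §1.4, Thms. 6.3, 6.6; [DolezalekMichalek2026]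
  M. Doležálek, M. Michałek, *Nonlinear methods for tensors* (arXiv:2602.12762), §1, Thm. 1.1,
  Thm. 3.3, Cor. 3.5; [Buczynski2026] J. Buczyński, *Cactus barriers* (arXiv:2602.11309), §1.3,
  Thm. 2; [Koiran2020] P. Koiran, *On tensor rank and commuting matrices* (arXiv:2006.02374), §1.2
  — the audit's sources (narrowed entry).
-/

noncomputable section

namespace Literature.Barriers.ValiantsHypothesis

open Literature.Computability.AlgebraicComplexity MvPolynomial

/-! ### Technique classes: `T_k`-rank methods certifying a bound -/

/-- **Technique class (tensors).** A `T_k`-rank method CERTIFIES `trk(T) > B` for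
`T ∈ Ten(n,d)`: a linear `φ : Ten(n,d) → Ten(m,k)` and a bound `r` with `trk(φ(u₁ ⊗ ⋯ ⊗ u_d)) ≤ r`
on all rank-one tensors and `trk(φ(T)) > B · r` (by sub-additivity of `trk ∘ φ` this proves
`trk(T) > B`, Def. 1.6). No restriction on `m` or on the explicitness of `φ`, and no assumption on
how the degree-`k` bound `trk(φ(T)) > B · r` is obtained.
[cite: GargMakamOliveiraWigderson2019, Def. 1.12 (with Defs. 1.6–1.7)] -/
def TkRankMethodProves (F : Type) [Field F] (n d k B : ℕ) (T : (Fin d → Fin n) → F) : Prop :=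
  ∃ (m : ℕ) (φ : ((Fin d → Fin n) → F) →ₗ[F] ((Fin k → Fin m) → F)) (r : ℕ),
    (∀ u : Fin d → Fin n → F, tensorRankD (φ (rankOneTensor u)) ≤ r) ∧ B * r < tensorRankD (φ T)

/-- **Technique class (forms).** A `T_k`-rank method on `P(n,d)` certifies `wrk(f) > B` for a
form `f` of degree `d`: a linear `φ` into `Ten(m,k)` with `trk(φ(ℓ^d)) ≤ r` for all linear forms
`ℓ` and `trk(φ(f)) > B · r`. [cite: GargMakamOliveiraWigderson2019, Def. 1.12 with Def. 1.4] -/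
def TkWaringMethodProves (F : Type) [Field F] (n d k B : ℕ) (f : MvPolynomial (Fin n) F) : Prop :=
  ∃ (m : ℕ) (φ : MvPolynomial (Fin n) F →ₗ[F] ((Fin k → Fin m) → F)) (r : ℕ),
    (∀ a : Fin n → F, tensorRankD (φ (linearForm a ^ d)) ≤ r) ∧ B * r < tensorRankD (φ f)

/-- Monotonicity of the technique class in the certified bound. [folklore] -/
theorem TkRankMethodProves.mono {F : Type} [Field F] {n d k B B' : ℕ} {T : (Fin d → Fin n) → F}
    (hB : B' ≤ B) (h : TkRankMethodProves F n d k B T) : TkRankMethodProves F n d k B' T := by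
  obtain ⟨m, φ, r, hr, hlt⟩ := h
  exact ⟨m, φ, r, hr, lt_of_le_of_lt (Nat.mul_le_mul_right _ hB) hlt⟩

/-! ### The printed results as named facts (D-0014) -/

/-- **Garg–Makam–Oliveira–Wigderson 2019, Thm. 1.14 (tensor-to-tensor lifting).** Over an
algebraically closed field of characteristic zero, for any `T_k`-rank method
`φ : Ten(n,d) → Ten(m,k)`, `Pot(φ) ≤ k^d · n^{⌊(k-1)d/k⌋}`: if every rank-one tensor is mapped to
a tensor of rank `≤ r`, then `trk(φ(T)) ≤ k^d · n^{⌊(k-1)d/k⌋} · r` for every `T`. Stated for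
`k ≥ 2` (the paper's standing `d > k ≥ 2`; "holds for all values of `k, d, n, m`").
[cite: GargMakamOliveiraWigderson2019, Thm. 1.14] -/
def GMOW2019_thm114 : Prop :=
  ∀ (F : Type) [Field F] [IsAlgClosed F] [CharZero F] (n d m k : ℕ), 2 ≤ k →
    ∀ (φ : ((Fin d → Fin n) → F) →ₗ[F] ((Fin k → Fin m) → F)) (r : ℕ),
      (∀ u : Fin d → Fin n → F, tensorRankD (φ (rankOneTensor u)) ≤ r) →
      ∀ T : (Fin d → Fin n) → F, tensorRankD (φ T) ≤ k ^ d * n ^ ((k - 1) * d / k) * r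

/-- **Garg–Makam–Oliveira–Wigderson 2019, Thm. 1.16 (form-to-tensor lifting).** Over an
algebraically closed field of characteristic zero there is, for all `d, k`, a constant `B_{d,k}`
such that every `T_k`-rank method `φ : P(n,d) → Ten(m,k)` has `Pot(φ) ≤ B_{d,k} · n^{⌊(k-1)d/k⌋}`
(simples: `d`-th powers of linear forms; elements: forms of degree `d`). Stated for `k ≥ 2`.
[cite: GargMakamOliveiraWigderson2019, Thm. 1.16] -/
def GMOW2019_thm116 : Prop :=
  ∀ (d k : ℕ), 2 ≤ k → ∃ Bdk : ℕ, ∀ (F : Type) [Field F] [IsAlgClosed F] [CharZero F] (n m : ℕ)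
    (φ : MvPolynomial (Fin n) F →ₗ[F] ((Fin k → Fin m) → F)) (r : ℕ),
      (∀ a : Fin n → F, tensorRankD (φ (linearForm a ^ d)) ≤ r) →
      ∀ f : MvPolynomial (Fin n) F, f.IsHomogeneous d →
        tensorRankD (φ f) ≤ Bdk * n ^ ((k - 1) * d / k) * r

/-! ### The barrier fact and the no-go theorems -/

/-- **Barriers for lifting rank lower bounds (GMOW 2019, Thms. 1.14 and 1.16).**

BARRIER
technique_class: generalised-rank-methods, rank-lifting, escalation, Tk-rank-methods, Wk-rank-methods, sub-additive-measures, higher-flattenings, matrix-rank-methods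
blocks: lifting / escalation of tensor-rank lower bounds from degree `k` to degree `d > k` via linear maps (`T_k`-rank methods `μ_φ = trk ∘ φ`, Def. 1.12; `TkRankMethodProves`, `TkWaringMethodProves`; sub-additive measures, flattenings to higher tensors, matrix-rank methods as `k = 2`), in particular the lifting route to the near-optimal explicit tensor-rank (or Waring-rank) lower bounds whose degree-`d` versions would give formula lower bounds for the permanent via Raz's elusive-functions/tensor-rank connection ("optimal lower bounds on `k`-tensors (for `k` superconstant and `≤ log(n)/log(log(n))` ...) can be lifted ... Raz [Raz-elusive] shows how they can imply super-polynomial formula lower bounds") [cite: GargMakamOliveiraWigderson2019, §1] [cite: Raz2013, §1.4]: no `T_k`-rank method certifies `trk(T) > k^d · n^{⌊(k-1)d/k⌋}` for ANY `d`-tensor `T` of side `n` (`RankLifting.not_tkRankMethodProves`, proved from Thm. 1.14), within the constant `k^d` of the trivial regrouping (Ex. 1.13) and far from the generic rank `≥ n^{d-1}/d` — "even optimal lower bounds on the rank of degree `k` tensors (polynomials) cannot yield any nontrivial lower bounds for any `d > k` for any fixed `d`, (up to constant factors)" [cite: GargMakamOliveiraWigderson2019, §1 and Thm. 1.14]; e.g.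 for `Ten(n,4)` and `k = 3` nothing super-quadratic (`RankLifting.not_tkRankMethodProves_four_three`) [cite: GargMakamOliveiraWigderson2019, Rem. 1.15]; likewise for forms of degree `d` up to a constant `B_{d,k}` (`RankLifting.not_tkWaringMethodProves`) [cite: GargMakamOliveiraWigderson2019, Thm. 1.16], and for `W_k`-methods, border rank, cactus and set-multihomogeneous rank [cite: GargMakamOliveiraWigderson2019, Thms. 1.18–1.19 and §1.6].
because: as in EGOW, compose `φ` with the degree-`d` (set-multilinear) parametrisation of the simples to get a polynomial map `L` with `trk(L(β)) ≤ a` for all evaluations; a symbolic rank-`a` decomposition of `L(z + c)` into tensor products of power-series vectors, truncated to total degree `≤ d`, shows that in each term one factor has small degree, so all `φ(s)` lie in a fixed sum of subspaces `U_1 ⊗ 𝔽 ⊗ ⋯ + ⋯` spanned by few coefficient vectors, a set closed under addition — hence so does every `φ(v)`, bounding `μ_φ(V)` (Lemma 3.1 and the proof sketch of §3.1); for `k > 2` tensor rank is not given by polynomial equations, so the symbolic decomposition over the function field fails and is replaced by the numeric-to-symbolic transfer (Thm. 1.21 / Cor. 1.23: `im L ⊆ im M` for polynomial maps forces `L(z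 + c) = M(p(z))` with power series `p`, via algebraic functions over the algebraic closure of the function field, Prop. 3.3, and an étale-local passage to power series in characteristic zero, Prop. 3.4) [cite: GargMakamOliveiraWigderson2019, §3.1 (Lemma 3.1), §3.2 (Props. 3.3–3.4), §1.5 (Thm. 1.21, Cor. 1.23)].
evasions_known: techniques outside sub-additive rank measures are not covered (as for EGOW; e.g. the substitution method gains constant factors) [cite: EfremenkoGargOliveiraWigderson2018, §1.4]; the results need characteristic zero ("our more general results in this paper only hold for characteristic zero"), unlike EGOW's [cite: GargMakamOliveiraWigderson2019, §1]; the authors flag the tension with Raz's lifting of super-constant-`k` tensor-rank bounds to formulas as requiring "better understanding and reconciling" — the barrier is for FIXED `d` up to the constant `k^d`, which is not constant when `d` grows [cite: GargMakamOliveiraWigderson2019, §1 and Thm. 1.14].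
scope_caveats: potency bounds are up to the factor `k^d` (tensors) or an inexplicit `B_{d,k}` (forms), so for growing `d` (the regime of Raz's route, `d ≤ log n / log log n`) the printed bound `k^d n^{⌊(k-1)d/k⌋}` is not within a constant of the trivial method and the paper claims nothing sharper [cite: GargMakamOliveiraWigderson2019, Thm. 1.14]; only tensor rank and Waring rank (and in §§7–8 border/cactus/set-multihomogeneous rank) as TARGET measures — nothing about general circuits, `VP`, or the permanent-versus-determinant flattenings; algebraically closed characteristic-zero fields only; the Lean facts carry `2 ≤ k` (print: `d > k ≥ 2` standing, "all values" claimed) and render potency multiplicatively; AUDIT 2026-08-16 (barrier audit, D-0021): the fact is PROVED in the tree (`RankLifting_holds`, `RankLiftingBarrierHolds.lean`) and faithful to the print, but the tags `generalised-rank-methods`, `rank-lifting`, `escalation`, `sub-additive-measures`, `higher-flattenings` of this block and the Raz clause of `blocks:` are to be read ONLY in the sense fixed by `RankLiftingNarrow` at the end of this file — LINEAR `φ` on the tensor / form itself, tensor-rank or Waring-rank TARGET, sub-additive certificate, `k` fixed, characteristic `0`; outside it (see the `evasions_known:` there): Raz-type escalation from PT-rank / multiquadratic sums of squares, for which the printed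 ceilings are vacuous [cite: RossmanZhu2025, §1.4 and Cor. 1.6], NONLINEAR (Kronecker-power) flattenings [cite: DolezalekMichalek2026, §1 (p. 3) and Thm. 3.3] [cite: EfremenkoGargOliveiraWigderson2018, §6], super-constant `k` [cite: GargMakamOliveiraWigderson2019, §1], and positive characteristic for `k ≥ 3`.
status: theorem (established; proved in the tree) [cite: GargMakamOliveiraWigderson2019, Thm. 1.14 and Thm. 1.16] -/
def RankLifting : Prop :=
  GMOW2019_thm114 ∧ GMOW2019_thm116

/-- Unfolding of the barrier fact. [folklore] -/
theorem rankLifting_iff : RankLifting ↔ GMOW2019_thm114 ∧ GMOW2019_thm116 :=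
  Iff.rfl

/-- **No `T_k`-rank method certifies tensor rank above `k^d · n^{⌊(k-1)d/k⌋}`** for any
`d`-tensor of side `n` over an algebraically closed field of characteristic zero (`k ≥ 2`).
[cite: GargMakamOliveiraWigderson2019, Thm. 1.14] -/
theorem RankLifting.not_tkRankMethodProves (h : RankLifting) (F : Type) [Field F]
    [IsAlgClosed F] [CharZero F] (n d : ℕ) {k : ℕ} (hk : 2 ≤ k) (T : (Fin d → Fin n) → F) :
    ¬ TkRankMethodProves F n d k (k ^ d * n ^ ((k - 1) * d / k)) T := by
  rintro ⟨m, φ, r, hr, hlt⟩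
  have hle : tensorRankD (φ T) ≤ k ^ d * n ^ ((k - 1) * d / k) * r := h.1 F n d m k hk φ r hr T
  exact absurd hlt (not_lt.2 hle)

/-- The case of Rem. 1.15: for `4`-tensors and `T_3`-rank methods (an oracle for the rank of
`3`-tensors) nothing beyond `3^4 · n^{⌊8/3⌋} = 81 n²` — no super-quadratic bound.
[cite: GargMakamOliveiraWigderson2019, Rem. 1.15] -/
theorem RankLifting.not_tkRankMethodProves_four_three (h : RankLifting) (F : Type) [Field F]
    [IsAlgClosed F] [CharZero F] (n : ℕ) (T : (Fin 4 → Fin n) → F) :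
    ¬ TkRankMethodProves F n 4 3 (81 * n ^ 2) T := by
  simpa using h.not_tkRankMethodProves F n 4 (k := 3) (by norm_num) T

/-- Matrix-rank methods are the case `k = 2`: no `T_2`-rank method (flattening to matrices viewed
as `2`-tensors) certifies tensor rank above `2^d · n^{⌊d/2⌋}`, recovering the shape of EGOW's
Thm. 1.1 inside this framework. [cite: GargMakamOliveiraWigderson2019, Thm. 1.14 ("it recovers (with k=2) Theorem 1.10")] -/
theorem RankLifting.not_tkRankMethodProves_two (h : RankLifting) (F : Type) [Field F]
    [IsAlgClosed F] [CharZero F] (n d : ℕ) (T : (Fin d → Fin n) → F) :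
    ¬ TkRankMethodProves F n d 2 (2 ^ d * n ^ (d / 2)) T := by
  have := h.not_tkRankMethodProves F n d (k := 2) le_rfl T
  simpa using this

/-- **Forms:** for every `d` and `k ≥ 2` there is a constant `B_{d,k}` such that no `T_k`-rank
method certifies Waring rank above `B_{d,k} · n^{⌊(k-1)d/k⌋}` for any form of degree `d` in `n`
variables. [cite: GargMakamOliveiraWigderson2019, Thm. 1.16] -/
theorem RankLifting.not_tkWaringMethodProves (h : RankLifting) (d : ℕ) {k : ℕ} (hk : 2 ≤ k) :
    ∃ Bdk : ℕ, ∀ (F : Type) [Field F] [IsAlgClosed F] [CharZero F] (n : ℕ)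
      (f : MvPolynomial (Fin n) F), f.IsHomogeneous d →
        ¬ TkWaringMethodProves F n d k (Bdk * n ^ ((k - 1) * d / k)) f := by
  obtain ⟨Bdk, hB⟩ := h.2 d k hk
  refine ⟨Bdk, fun F _ _ _ n f hf => ?_⟩
  rintro ⟨m, φ, r, hr, hlt⟩
  have hle := hB F n m φ r hr f hf
  exact absurd hlt (not_lt.2 hle)

/-! ## Narrowed catalogue entry (barrier audit 2026-08-16, D-0021)

The mathematics of `RankLifting` is confirmed — it is a theorem of the tree (`RankLifting_holds` in
`RankLiftingBarrierHolds.lean`, axioms `propext`, `Classical.choice`, `Quot.sound`) and the two facts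
match Thms. 1.14 / 1.16 as printed (p. 6: "`Pot(φ) ≤ A_{d,k} · n^{⌊(k-1)d/k⌋}`, where `A_{d,k} = k^d`.
The theorem holds for all values of `k, d, n, m`!"; the ranges `d ≤ k`, `n = 0`, `d = 0` of the Lean
statements are trivially true). What is narrowed is the READING of the block: its tags
`sub-additive-measures`, `escalation`, `rank-lifting`, `higher-flattenings`,
`generalised-rank-methods` and the Raz clause of `blocks:` are wider than the printed argument,
which quantifies over LINEAR maps `φ` on `Ten(n,d)` / `P(n,d)` read with the sub-additive
certificate for TENSOR rank / WARING rank (Def. 1.12 with Defs. 1.6–1.7), `k` fixed,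
characteristic `0` (Lemma 5.8 needs the exponents of the truncated power series to be `0/1`
vectors, §5.2). `RankLiftingNarrow` restates the entry in that exact certificate form and carries
the corrected block; `RankLiftingNarrow.four_three_cube` / `.tensorPower_gap` record what the
print leaves open for `T_k`-methods applied to tensor POWERS, and
`RankLiftingNarrow.pow_le_ceiling_double` the arithmetic behind the vacuity of the ceilings for
targets bounded by `n^d` on `2d`-tensors (PT-rank). -/

section Narrow

/-- **What a `T_k`-rank method certifies is below the ceiling** (certificate form of Thm. 1.14):
over an algebraically closed field of characteristic zero, if a `T_k`-rank method (`k ≥ 2`)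
certifies `trk(X) > B` for a `D`-tensor `X` of side `n` (`TkRankMethodProves F n D k B X`), then
`B < k^D · n^{⌊(k-1)D/k⌋}`; equivalent to `RankLifting.not_tkRankMethodProves` by monotonicity in
`B` (`TkRankMethodProves.mono`). [cite: GargMakamOliveiraWigderson2019, Thm. 1.14] -/
theorem RankLifting.certifies_lt (h : RankLifting) (F : Type) [Field F] [IsAlgClosed F] [CharZero F]
    {n D k B : ℕ} (hk : 2 ≤ k) {X : (Fin D → Fin n) → F} (hX : TkRankMethodProves F n D k B X) :
    B < k ^ D * n ^ ((k - 1) * D / k) := by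
  by_contra hB
  exact h.not_tkRankMethodProves F n D hk X (hX.mono (not_lt.1 hB))

/-- **Forms:** for every `d` and `k ≥ 2` there is `B_{d,k}` such that whatever a `T_k`-rank method
certifies for the Waring rank of a form of degree `d` in `n` variables is `< B_{d,k} · n^{⌊(k-1)d/k⌋}`
(certificate form of Thm. 1.16). [cite: GargMakamOliveiraWigderson2019, Thm. 1.16] -/
theorem RankLifting.waring_certifies_lt (h : RankLifting) (d : ℕ) {k : ℕ} (hk : 2 ≤ k) :
    ∃ Bdk : ℕ, ∀ (F : Type) [Field F] [IsAlgClosed F] [CharZero F] (n B : ℕ)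
      (f : MvPolynomial (Fin n) F), f.IsHomogeneous d →
        TkWaringMethodProves F n d k B f → B < Bdk * n ^ ((k - 1) * d / k) := by
  obtain ⟨Bdk, hB⟩ := h.2 d k hk
  refine ⟨Bdk, fun F _ _ _ n B f hf => ?_⟩
  rintro ⟨m, φ, r, hr, hlt⟩
  have hle := hB F n m φ r hr f hf
  exact Nat.lt_of_mul_lt_mul_right (lt_of_lt_of_le hlt hle)

/-- **Barriers for LINEAR lifting of rank lower bounds — the certificate form (narrowed catalogue
entry).** Over an algebraically closed field of characteristic zero: (1) whatever bound `B` a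
`T_k`-rank method (`k ≥ 2`; a LINEAR `φ : Ten(n,D) → Ten(m,k)`, any `m`, explicit or not, read with
the sub-additive certificate `trk(X) > trk(φX)/max_{rank-one} trk ∘ φ`) certifies for the tensor rank
of a `D`-tensor `X` of side `n` satisfies `B < k^D · n^{⌊(k-1)D/k⌋}`; (2) for forms of degree `d`,
`B < B_{d,k} · n^{⌊(k-1)d/k⌋}`. This is `RankLifting` (Thms. 1.14 / 1.16, proved in the tree as
`RankLifting_holds`) in quotient-free certificate form [cite: GargMakamOliveiraWigderson2019, Thm. 1.14, Thm. 1.16 and Def. 1.12].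

BARRIER
technique_class: Tk-rank-method-linear, Wk-rank-method-linear, matrix-rank-method-as-k-equals-2, linear-higher-flattening, linear-rank-lifting-fixed-k, tensor-rank-subadditive-certificate, waring-rank-subadditive-certificate, border-rank-Tk-certificate
blocks: LINEAR lifting of degree-`k` rank lower bounds to degree `D > k`: for every linear `φ : Ten(n,D) → Ten(m,k)` (resp. `P(n,d) → Ten(m,k)`; `W_k`- and border-rank versions likewise in print) and every bound `r ≥ trk(φ s)` on the simples, the certified bound is `< k^D · n^{⌊(k-1)D/k⌋}` (resp. `< B_{d,k} n^{⌊(k-1)d/k⌋}`; `W_k`: `2^{k-1} k^d`, `2^{k-1} B_{d,k}`) — for EVERY `D`-tensor / form, explicit or not, any `m`, any strength of the degree-`k` bound ("even if one had access to an oracle for tensor rank of `3`-tensors, one could still not prove super-quadratic lower bounds for the tensor rank of tensors in `Ten(n,4)`" by such a `φ`) (this theorem; `RankLifting.not_tkRankMethodProves_four_three`, `_two`) [cite: GargMakamOliveiraWigderson2019, Thm. 1.14, Rem. 1.15, Thm. 1.16, Thms. 1.18–1.19 and §7]; consequently, with `k` FIXED, no such method reaches the threshold `n^{d(1-o(1))}`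 of Raz's tensor-rank route to formula lower bounds (`k^d n^{⌊(k-1)d/k⌋} ≤ n^{d(1 - 1/k) + d log k/log n}`) [cite: Raz2013, §1.4] [cite: GargMakamOliveiraWigderson2019, §1].
because: unchanged — numeric-to-symbolic transfer (Thm. 1.21 / Cor. 1.23, Props. 3.3–3.4, characteristic `0`), truncation of the power-series rank decomposition of `L(z + c) = φ(ψ(z + c))` by set-multidegree, support subsets `I ∈ SP(d,k)` (`|SP(d,k)| = k^d`), basic subspaces `⊗_j 𝒞^i_{I_j}` with `dim 𝒞^i_{I_j} ≤ n^{|I_j|}` and `r(⊗_j U_j) ≤ ∏_{j ≠ p} dim U_j`, `∑_{j ≠ r} |I_j| ≤ ⌊(k-1)d/k⌋` [cite: GargMakamOliveiraWigderson2019, §5 (Lemmas 5.2, 5.4, 5.8, 5.10, Cor. 5.9) and §3]; formalised in `RankLiftingBarrierProofs.lean` / `RankLiftingBarrierFormsProofs.lean`.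
evasions_known: NOT covered (the theorems say nothing about them): (i) OTHER TARGET RANKS with a Raz-type escalation — partial-transpose rank / multiquadratic sums of squares: an explicit sequence of `n^d × n^d` matrices `M` with `PT-rank(M) ≥ n^{d - o(log d)}`, `ω(1) ≤ d(n) ≤ O(log n/log log n)`, gives `VNC¹ ≠ VNP` (set-multilinear formula size of `Q̃_M` is `≥ PT-rank(M)/n^{d - log d + 1}`), and "Theorem 1.3 appears to evade the known barriers for rank-based lower bound methods identified by [EGOW18] and [GMOW19]" [cite: RossmanZhu2025, Thm. 1.5, Cor. 1.6 and §1.4]; indeed PT-basic matrices include all rank-one `2d`-tensors and `PT-rank ≤ rank ≤ n^d`, while the printed ceilings for `2d`-tensors of side `n` are `2^{2d} n^d` (`k = 2`) and `k^{2d} n^{⌊2(k-1)d/k⌋} ≥ n^d` (`RankLiftingNarrow.pow_le_ceiling_double`), above every PT-rank — vacuous for this target [folklore]; printed limits of that route: `PT-rank ≤ n^{0.81d + O(1)}` when the shifted tensor is in `VBP_ord`, `≤ n^{O(d^{0.7})}` for Kronecker products [cite: RossmanZhu2025, Thm. 6.6 and Thm. 6.3]. (ii) NONLINEAR maps — EGOW's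 first open problem ("can they be expanded to the use of non-linear mappings `L`, possibly of low degree?") [cite: EfremenkoGargOliveiraWigderson2018, §6]: degree-`σ` maps `T ↦ φ(T^{⊗σ} ⊗ J)` (Kronecker–Koszul / Kronecker–Young / tangency flattenings) read with a SECANT-SPECIFIC count `F(q) = χ_G(q) ≤ q^σ` of the induced decomposition give determinantal equations of `σ_n(Seg)` not vanishing on the cactus variety ("it is not the determinantal expression which creates the cactus barrier, but rather the linear embedding") [cite: DolezalekMichalek2026, §1 (p. 3), Thm. 3.3, Cor. 3.5 and Thm. 1.1]; read instead with the PLAIN count `trk(T^{⊗σ}) ≤ trk(T)^σ`, a `T_k`-method on the power is a `T_k`-method on `Ten(n, σd)` and this theorem bounds its certificate only by `B^σ < k^{σd} n^{⌊(k-1)σd/k⌋}`, i.e. `B < k^d n^{⌊(k-1)σd/k⌋/σ} → k^d n^{(k-1)d/k}`: for `k ∣ d` nothing is gained, for `k = 2` nothing is gained either — border cactus rank is submultiplicative (`⟨R × R'⟩ = ⟨R⟩ ⊗ ⟨R'⟩`, lengths multiply) and linear methods only see cactus rank, in every characteristic, so the certificate stays below the generic cactus rank of `Ten(n,d)` itself,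 `O_d(n^{⌊d/2⌋})` [cite: Buczynski2026, Thm. 2 and §1.3] [folklore] — but for `k ≥ 3`, `k ∤ d` the print leaves the window `[k^d n^{⌊(k-1)d/k⌋}, k^d n^{(k-1)d/k})` open — `Ten(n,4)`, `k = 3`, `σ = 3`: `B³ < 3^{12} n^8` does not give Rem. 1.15's `B ≤ 81 n²` (`RankLiftingNarrow.four_three_cube`, `.tensorPower_gap`), no cactus analogue being known for `T_k`-methods [cite: GargMakamOliveiraWigderson2019, Rem. 1.20] (a factor `< n`, immaterial in Raz's regime) [folklore]. (iii) SUPER-CONSTANT `k`: `k^d n^{⌊(k-1)d/k⌋}` with `k = k(n) → ∞` does not exclude `n^{d(1-o(1))}` — "optimal lower bounds on `k`-tensors (for `k` superconstant and `≤ log(n)/log(log(n))` ...) can be lifted ... Raz shows how they can imply super-polynomial formula lower bounds! ... better understanding and reconciling these results is needed" [cite: GargMakamOliveiraWigderson2019, §1] [cite: Raz2013, §1.4]. (iv) POSITIVE CHARACTERISTIC, `k ≥ 3`: unproved ("our more general results in this paper only hold for characteristic zero"; the transfer Cor. 1.23 fails under Frobenius: `z ∈ im(y ↦ y^p)` has no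 power-series preimage) while `k = 2` holds in all characteristics [cite: GargMakamOliveiraWigderson2019, §1 and §1.5] [cite: Buczynski2026, Thm. 2]; since `trk ≤ r` is an existential sentence with integer parameters, `trk_ℂ(T) = trk_{𝔽̄_p}(T)` for all large `p` for an integer tensor `T`, so bounds proved over `𝔽̄_p` for infinitely many `p` pass to `ℂ` [folklore]. (v) NOT RANK METHODS at all: general sub-additive measures of Def. 1.6 (tensor rank itself is one, of full potency — no barrier can cover the bare tag), the substitution method, characterisations equivalent to rank ("the 'commutation approach' ... is immune to the barrier result from [EGOW18]") [cite: Koiran2020, §1.2], apolarity / Hilbert-function arguments, and escalations that are reductions between models rather than measures (Raz's tensor-rank-to-formulas; sums of squares to non-commutative circuits) [cite: Raz2013, §1.4] [cite: RossmanZhu2025, Thm. 1.2 and §1.4] [cite: EfremenkoGargOliveiraWigderson2018, §1.4].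
scope_caveats: (a) this declaration supersedes only the `technique_class:` / `blocks:` READING of `RankLifting`; the proposition, its no-go corollaries and its tree proof are unchanged; (b) fixed `d, k ≥ 2`: constants `k^d` (tensors), inexplicit `B_{d,k}` (forms; `2^d k^d` suffices, `RankLiftingBarrierForms.lean`), so nothing within a constant of the trivial method once `d` grows [cite: GargMakamOliveiraWigderson2019, Thm. 1.14 and Thm. 1.16]; (c) TARGETS: tensor rank, Waring rank, and in print border / cactus / set-multihomogeneous rank (§§7–8, not vendored) — not PT-rank, not formula or circuit size, not `VP`; (d) algebraically closed characteristic-`0` fields; Lean: `2 ≤ k`, potency rendered multiplicatively, certificate form `B · r < trk(φ X)`; (e) the tensor-power window of (ii) and the characteristic-`p` case of (iv) are OPEN, not claimed false.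
status: theorem (corollary of `RankLifting`, which is proved in the tree: `RankLifting_holds`) [cite: GargMakamOliveiraWigderson2019, Thm. 1.14 and Thm. 1.16] -/
theorem RankLiftingNarrow (h : RankLifting) :
    (∀ (F : Type) [Field F] [IsAlgClosed F] [CharZero F] (n D k B : ℕ), 2 ≤ k →
        ∀ X : (Fin D → Fin n) → F, TkRankMethodProves F n D k B X →
          B < k ^ D * n ^ ((k - 1) * D / k)) ∧
    (∀ (d k : ℕ), 2 ≤ k → ∃ Bdk : ℕ, ∀ (F : Type) [Field F] [IsAlgClosed F] [CharZero F] (n B : ℕ)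
        (f : MvPolynomial (Fin n) F), f.IsHomogeneous d →
          TkWaringMethodProves F n d k B f → B < Bdk * n ^ ((k - 1) * d / k)) :=
  ⟨fun F _ _ _ _ _ _ _ hk _ hX => h.certifies_lt F hk hX, fun d _ hk => h.waring_certifies_lt d hk⟩

/-- **Tensor powers, the case of Rem. 1.15.** A `T_3`-certificate `B³` on a `12`-tensor `X` of side
`n` — the shape of the PLAIN-count use of a `3`-tensor-rank oracle on the tensor cube `T^{⊗3}` of a
`4`-tensor `T` (`trk(T^{⊗3}) ≤ trk(T)^3`, so certifying `trk(T^{⊗3}) > B³` certifies `trk(T) > B`)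
— is bounded by Thm. 1.14 only as `B³ < 3^{12} · n^{⌊2·12/3⌋} = 3^{12} n^8`.
[cite: GargMakamOliveiraWigderson2019, Thm. 1.14 and Rem. 1.15] -/
theorem RankLiftingNarrow.four_three_cube (h : RankLifting) (F : Type) [Field F] [IsAlgClosed F]
    [CharZero F] {n B : ℕ} {X : (Fin 12 → Fin n) → F} (hX : TkRankMethodProves F n 12 3 (B ^ 3) X) :
    B ^ 3 < 3 ^ 12 * n ^ 8 := by
  simpa using h.certifies_lt F (k := 3) (by norm_num) hX

/-- … and `B³ < 3^{12} n^8` does NOT imply the quadratic ceiling `B ≤ 81 n²` of Rem. 1.15 for linear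
`T_3`-methods on `Ten(n,4)` itself: `n = 8`, `B = 5185 > 81 · 64` has `B³ < 3^{12} · 8^8`. The window
`(81 n², 81 n^{8/3})` for `T_3`-methods on tensor powers of `4`-tensors is left open by the print.
[folklore] -/
theorem RankLiftingNarrow.tensorPower_gap : ∃ n B : ℕ, 81 * n ^ 2 < B ∧ B ^ 3 < 3 ^ 12 * n ^ 8 :=
  ⟨8, 5185, by norm_num, by norm_num⟩

/-- **The ceilings are vacuous for targets bounded by `n^d` on `2d`-tensors** (the arithmetic behind
evasion (i), PT-rank `≤ n^d`): for `k ≥ 2` and `n ≥ 1`, `n^d ≤ k^{2d} · n^{⌊(k-1)·2d/k⌋}`. [folklore] -/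
theorem RankLiftingNarrow.pow_le_ceiling_double {k n : ℕ} (hk : 2 ≤ k) (hn : 1 ≤ n) (d : ℕ) :
    n ^ d ≤ k ^ (2 * d) * n ^ ((k - 1) * (2 * d) / k) := by
  have hk0 : 0 < k := by omega
  have hd : d ≤ (k - 1) * (2 * d) / k := by
    rw [Nat.le_div_iff_mul_le hk0]
    have h1 : (k - 1) * (2 * d) = d * k + d * (k - 2) := by
      obtain ⟨j, rfl⟩ : ∃ j, k = j + 2 := ⟨k - 2, by omega⟩
      rw [show j + 2 - 1 = j + 1 by omega, show j + 2 - 2 = j by omega]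
      ring
    rw [h1]
    exact Nat.le_add_right _ _
  calc n ^ d ≤ n ^ ((k - 1) * (2 * d) / k) := Nat.pow_le_pow_right hn hd
    _ ≤ k ^ (2 * d) * n ^ ((k - 1) * (2 * d) / k) :=
        Nat.le_mul_of_pos_left _ (pow_pos hk0 _)

end Narrow

end Literature.Barriers.ValiantsHypothesis
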